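import Summits.Ventures.GridStability.Bench.NE39SPLineSwitch2A
import Summits.Ventures.GridStability.Bench.NE39SPLineSwitch2B
import Summits.Ventures.GridStability.Bench.NE39SPLineSwitch2C
import Summits.Ventures.GridStability.Bench.NE39SPLineSwitch2D
import Summits.Ventures.GridStability.Bench.NE39SPLineSwitch2E
import Summits.Ventures.GridStability.Bench.NE39SPLineSwitch2F
import Summits.Ventures.GridStability.Bench.NE39SPLineSwitch2G
import Summits.Ventures.GridStability.Bench.NE39SPLineSwitch2H
import Summits.Ventures.GridStability.Bench.NE39SPLineSwitch2I
import Summits.Ventures.GridStability.Bench.NE39SPLineSwitch2I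
import Summits.Ventures.GridStability.Bench.NE39SPLineSwitchAll
import HarnessLib

/-!
# GridStability/Bench/NE39SPLineSwitch2All — the N−2 table over the TEN HEAVIEST-LOADED switchable branches of
# the 49-node STRUCTURE-PRESERVING New England instance (column LF): of the 45 pairs, 42 carry a kernel double-
# switching certificate and 3 island a bus set (certified cuts) — uniform sentence and machine-speed bound

Cell `gridfusion` (LADDER-GRIDFUSION), seat gridfusion-lyap-1 (g9), line «G2.b-NE39SP-N1-SWITCH» (N−2 extension).
INSTANCE OF RECORD BY NAME: model-2's `Models/NE39SP.lean` ([cite: Padiyar2013, App. D]); pair certificates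
`n2certK_L`/`n2checkK_L`/`open2_K_L_resync` (`Bench/NE39SPLineSwitch2A…I.lean`); `wOpen2`, `paramsOpen2`,
`switch2_resync_open` (`Bench/NE39SPSwitch2Defs.lean`); `not_preconnected_of_cut`, `speed_le_of_energy_le`
(`Bench/NE39SPLineSwitchAll.lean`). NO NEW CERTIFICATE DATA (the pair sets and three island node sets only).

THREE COLUMNS. CERTIFIED (kernel): `heavyBranches_sub_switchable` (the ten selected edges are switchable branches);
`pairs_partition` (the 45 unordered pairs of the ten = 42 certified + 3 islanding, by decide); `islandingPairs_not_preconnected`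
(for the 3 pairs and every `D` the post-switch coupling graph is disconnected — certified cuts); `exists_n2cert`
(42/42 carry a certificate with `R = 10⁻⁶`, `τγ = 21/100`, `c ≤ 227 / 50`); **`n2_switch_resync`** (uniform sentence:
for EVERY certified pair and EVERY `D > 0`, existence of the post-switch synchronous state and re-synchronisation of
every solution from the pre-switch synchronous state with `V ≤ c` throughout); **`n2_machine_speed_bound`**
(`|δ̇ᵢ(t)| ≤ √(2c/Mᵢ)` along those transients). MODELLED: as the N−1 files + «two branches opened at the same instant
without fault; the pair set is the declared selection 'ten heaviest pre-switch flows', NOT a complete N−2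
enumeration». VALIDATED: nothing. No sentence of this file says the New England system is stable or N−2 secure.
Three small `Finset` definitions + one island table; no named fact; standard axioms.
-/

noncomputable section

open Set Filter Topology Real Finset
open Summit.Ventures.GridStability.Models
open Summit.Ventures.GridStability.Models.StructurePreserving
open Summit.Ventures.GridStability.Models.NE39SP
open Summit.Ventures.GridStability.Lyapunov.StructurePreserving
open Summit.Ventures.GridStability.Lyapunov.StructurePreserving.Switch

namespace Summit.Ventures.GridStability.Bench.NE39SP

/-- The ten heaviest-loaded switchable branches (edge indices; pre-switch |flow| 3.1–6.0 pu, generator float —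
the selection criterion is VALIDATED bookkeeping, the set itself is the declared object). [folklore] -/
def heavyBranches : Finset (Fin 56) := {22, 28, 29, 30, 31, 34, 36, 37, 39, 46}

/-- The selected branches are switchable branches (class 1 of `NE39SPLineSwitchAll`), ten of them. [folklore] -/
theorem heavyBranches_sub_switchable : heavyBranches ⊆ switchable ∧ heavyBranches.card = 10 := by
  constructor
  · decide +kernel
  · decide +kernel

/-- The 42 CERTIFIED pairs (ordered as `(k, l)` with `k < l`). [folklore] -/
def certifiedPairs : Finset (Fin 56 × Fin 56) := {(22, 28), (22, 29), (22, 30), (22, 31), (22, 34), (22, 36), (22, 37), (22, 39), (22, 46), (28, 29), (28, 30), (28, 31), (28, 34), (28, 36), (28, 37), (28, 39), (28, 46), (29, 30), (29, 31), (29, 34), (29, 36), (29, 37), (29, 39), (29, 46), (30, 31), (30, 34), (30, 36), (30, 37), (30, 39), (30, 46), (31, 34), (31, 36), (31, 37), (31, 39), (31, 46), (34, 36), (34, 37), (34, 39), (34, 46), (36, 46), (37, 46), (39, 46)}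

/-- The 3 ISLANDING pairs. [folklore] -/
def islandingPairs : Finset (Fin 56 × Fin 56) := {(36, 37), (36, 39), (37, 39)}

/-- **Partition of the pair set**: a pair `(k, l)` with `k < l` of heavy branches is EITHER certified OR islanding
(never both); `42 + 3 = 45`. [folklore] -/
theorem pairs_partition :
    (∀ k ∈ heavyBranches, ∀ l ∈ heavyBranches, k < l →
      ((k, l) ∈ certifiedPairs ∧ (k, l) ∉ islandingPairs) ∨ ((k, l) ∉ certifiedPairs ∧ (k, l) ∈ islandingPairs)) ∧
    certifiedPairs.card = 42 ∧ islandingPairs.card = 3 := by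
  refine ⟨?_, ?_, ?_⟩
  · decide +kernel
  · decide +kernel
  · decide +kernel

/-! ### The three islanding pairs (certified cuts) -/

/-- Island node sets of the three islanding pairs (the smaller component; `∅` elsewhere). [folklore] -/
def islandSide2 : Fin 56 × Fin 56 → Finset (Fin 49) := fun p =>
    if p = (36, 37) then {20} else
    if p = (36, 39) then {5, 6, 21, 22, 44, 45} else
    if p = (37, 39) then {5, 6, 20, 21, 22, 44, 45} else ∅

/-- **The cut checks** (one `decide`): for each islanding pair the island and its complement are inhabited and no
post-switch coupling of `wOpen2 k l` crosses it. CERTIFIED column. [folklore] -/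
theorem islandCut2_checks : ∀ p ∈ islandingPairs,
    (∃ u : Fin 49, u ∈ islandSide2 p) ∧ (∃ v : Fin 49, v ∉ islandSide2 p) ∧
      ∀ e : Fin 56, wOpen2 p.1 p.2 e ≠ 0 → (NE39SP.srcV e ∈ islandSide2 p ↔ NE39SP.tgtV e ∈ islandSide2 p) := by
  decide +kernel

/-- **Islanding pairs certified**: opening any of the 3 islanding pairs leaves `paramsOpen2 k l D` with a
DISCONNECTED coupling graph (every `D`) — outside the switching theorem's hypotheses by proof. [folklore] -/
theorem islandingPairs_not_preconnected : ∀ p ∈ islandingPairs, ∀ D : Fin 49 → ℝ,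
    ¬ (paramsOpen2 p.1 p.2 D).couplingGraph.Preconnected := by
  intro p hp D
  obtain ⟨⟨u, hu⟩, ⟨v, hv⟩, hcut⟩ := islandCut2_checks p hp
  refine not_preconnected_of_cut (paramsOpen2 p.1 p.2 D) (fun i j => symmetrize_symm _ i j) (islandSide2 p) hu hv ?_
  intro i j hij
  rw [paramsOpen2_b] at hij
  obtain ⟨e, hwe, hor⟩ := exists_ne_zero_edge NE39SP.srcV NE39SP.tgtV (fun e => (wOpen2 p.1 p.2 e : ℝ)) hij
  have hwe' : wOpen2 p.1 p.2 e ≠ 0 := fun h => hwe (by simp [h])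
  have hiff := hcut e hwe'
  rcases hor with ⟨hs, ht⟩ | ⟨hs, ht⟩
  · subst hs; subst ht; exact hiff
  · subst hs; subst ht; exact hiff.symm

/-! ### The 42 certified pairs -/

/-- **42/42**: every certified pair carries a rational certificate (`R = 10⁻⁶`, `τγ = 21/100`, `c ≤ 227 / 50`) that PASSES
`Cert.check` against `wOpen2 k l` (the 42 `n2checkK_L` theorems, collected). CERTIFIED column. [folklore] -/
theorem exists_n2cert : ∀ p ∈ certifiedPairs, ∃ C : Cert 49 56,
    C.R = 1 / 1000000 ∧ C.τγ = 21 / 100 ∧ C.c ≤ 227 / 50 ∧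
      C.check NE39SP.srcV NE39SP.tgtV NE39SP.wtLFQ (wOpen2 p.1 p.2) NE39SP.tLFQ 39 := by
  intro p hp
  fin_cases hp
  exacts [⟨n2cert22_28, rfl, rfl, by decide +kernel, n2check22_28⟩,
    ⟨n2cert22_29, rfl, rfl, by decide +kernel, n2check22_29⟩,
    ⟨n2cert22_30, rfl, rfl, by decide +kernel, n2check22_30⟩,
    ⟨n2cert22_31, rfl, rfl, by decide +kernel, n2check22_31⟩,
    ⟨n2cert22_34, rfl, rfl, by decide +kernel, n2check22_34⟩,
    ⟨n2cert22_36, rfl, rfl, by decide +kernel, n2check22_36⟩,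
    ⟨n2cert22_37, rfl, rfl, by decide +kernel, n2check22_37⟩,
    ⟨n2cert22_39, rfl, rfl, by decide +kernel, n2check22_39⟩,
    ⟨n2cert22_46, rfl, rfl, by decide +kernel, n2check22_46⟩,
    ⟨n2cert28_29, rfl, rfl, by decide +kernel, n2check28_29⟩,
    ⟨n2cert28_30, rfl, rfl, by decide +kernel, n2check28_30⟩,
    ⟨n2cert28_31, rfl, rfl, by decide +kernel, n2check28_31⟩,
    ⟨n2cert28_34, rfl, rfl, by decide +kernel, n2check28_34⟩,
    ⟨n2cert28_36, rfl, rfl, by decide +kernel, n2check28_36⟩,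
    ⟨n2cert28_37, rfl, rfl, by decide +kernel, n2check28_37⟩,
    ⟨n2cert28_39, rfl, rfl, by decide +kernel, n2check28_39⟩,
    ⟨n2cert28_46, rfl, rfl, by decide +kernel, n2check28_46⟩,
    ⟨n2cert29_30, rfl, rfl, by decide +kernel, n2check29_30⟩,
    ⟨n2cert29_31, rfl, rfl, by decide +kernel, n2check29_31⟩,
    ⟨n2cert29_34, rfl, rfl, by decide +kernel, n2check29_34⟩,
    ⟨n2cert29_36, rfl, rfl, by decide +kernel, n2check29_36⟩,
    ⟨n2cert29_37, rfl, rfl, by decide +kernel, n2check29_37⟩,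
    ⟨n2cert29_39, rfl, rfl, by decide +kernel, n2check29_39⟩,
    ⟨n2cert29_46, rfl, rfl, by decide +kernel, n2check29_46⟩,
    ⟨n2cert30_31, rfl, rfl, by decide +kernel, n2check30_31⟩,
    ⟨n2cert30_34, rfl, rfl, by decide +kernel, n2check30_34⟩,
    ⟨n2cert30_36, rfl, rfl, by decide +kernel, n2check30_36⟩,
    ⟨n2cert30_37, rfl, rfl, by decide +kernel, n2check30_37⟩,
    ⟨n2cert30_39, rfl, rfl, by decide +kernel, n2check30_39⟩,
    ⟨n2cert30_46, rfl, rfl, by decide +kernel, n2check30_46⟩,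
    ⟨n2cert31_34, rfl, rfl, by decide +kernel, n2check31_34⟩,
    ⟨n2cert31_36, rfl, rfl, by decide +kernel, n2check31_36⟩,
    ⟨n2cert31_37, rfl, rfl, by decide +kernel, n2check31_37⟩,
    ⟨n2cert31_39, rfl, rfl, by decide +kernel, n2check31_39⟩,
    ⟨n2cert31_46, rfl, rfl, by decide +kernel, n2check31_46⟩,
    ⟨n2cert34_36, rfl, rfl, by decide +kernel, n2check34_36⟩,
    ⟨n2cert34_37, rfl, rfl, by decide +kernel, n2check34_37⟩,
    ⟨n2cert34_39, rfl, rfl, by decide +kernel, n2check34_39⟩,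
    ⟨n2cert34_46, rfl, rfl, by decide +kernel, n2check34_46⟩,
    ⟨n2cert36_46, rfl, rfl, by decide +kernel, n2check36_46⟩,
    ⟨n2cert37_46, rfl, rfl, by decide +kernel, n2check37_46⟩,
    ⟨n2cert39_46, rfl, rfl, by decide +kernel, n2check39_46⟩]

/-- **THE UNIFORM N−2 SENTENCE (42 pairs), MODEL MV-3, New England SP column LF.** For EVERY certified pair `(k, l)`
and EVERY `D > 0`: certificate data `C` (`R = 10⁻⁶`, `τγ = 21/100`, `c ≤ 227 / 50`, check passed) and a synchronous
angle vector `θ` of `paramsOpen2 k l D` (both branches opened at `t = 0` WITHOUT fault, injections of record kept)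
exist — all 49 power-flow equations exactly, `θ` within `10⁻⁶` rad of `halfAngle C.t1`, coupled branches inside
`2·arctan(21/100)` — and EVERY solution from the PRE-switch synchronous state keeps Vu–Turitsyn's polytope and
`V(θ; ·) ≤ c` for all `t ≥ 0`, converges to `θ + κ·1` and has machine speeds `→ 0`. No sentence here says the
New England system is stable or N−2 secure. [cite: VuTuritsyn2016, §IV, §VI; Padiyar2013, App. D] -/
theorem n2_switch_resync (p : Fin 56 × Fin 56) (hp : p ∈ certifiedPairs) (D : Fin 49 → ℝ) (hD : ∀ i, 0 < D i) :
    ∃ C : Cert 49 56, C.R = 1 / 1000000 ∧ C.τγ = 21 / 100 ∧ C.c ≤ 227 / 50 ∧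
      C.check NE39SP.srcV NE39SP.tgtV NE39SP.wtLFQ (wOpen2 p.1 p.2) NE39SP.tLFQ 39 ∧
      ∃ θ : Fin 49 → ℝ,
        θ 39 = halfAngle (fun i => (C.t1 i : ℝ)) 39 ∧
        (∀ i, |θ i - halfAngle (fun i => (C.t1 i : ℝ)) i| < (C.R : ℝ)) ∧
        (∀ i, (paramsOpen2 p.1 p.2 D).pe θ i = (paramsOpen2 p.1 p.2 D).P0 i) ∧
        (∀ i j, i ≠ j → (paramsOpen2 p.1 p.2 D).b i j ≠ 0 → |θ i - θ j| < 2 * Real.arctan (C.τγ : ℝ)) ∧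
        ∀ δ : ℝ → Fin 49 → ℝ, (paramsOpen2 p.1 p.2 D).IsSolution δ → δ 0 = NE39SP.δ₀ →
          (∀ i ∈ NE39SP.genS, deriv (fun u => δ u i) 0 = 0) →
          (∀ t, 0 ≤ t →
              (∀ i j, (paramsOpen2 p.1 p.2 D).b i j ≠ 0 → |(δ t i - δ t j) + (θ i - θ j)| < π) ∧
                (paramsOpen2 p.1 p.2 D).energy θ (δ t) (fun i => deriv (fun u => δ u i) t) ≤ (C.c : ℝ)) ∧
            Tendsto δ atTop (𝓝 fun i => θ i + (∑ j, D j * (NE39SP.δ₀ j - θ j)) / ∑ j, D j) ∧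
            ∀ i ∈ NE39SP.genS, Tendsto (fun t => deriv (fun u => δ u i) t) atTop (𝓝 0) := by
  obtain ⟨C, hR, hτ, hc, hchk⟩ := exists_n2cert p hp
  exact ⟨C, hR, hτ, hc, hchk, switch2_resync_open hchk D hD⟩

/-- **N−2 transient machine-speed bound (42 pairs).** Along every solution of `n2_switch_resync`'s situation, every
machine frequency deviation obeys `|δ̇ᵢ(t)| ≤ √(2c/Mᵢ)` for all `t ≥ 0` (`c ≤ 227 / 50`, printed inertias).
[cite: VuTuritsyn2016, §IV; Padiyar2013, §3.2 eq (3.11)] -/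
theorem n2_machine_speed_bound (p : Fin 56 × Fin 56) (hp : p ∈ certifiedPairs) (D : Fin 49 → ℝ)
    (hD : ∀ i, 0 < D i) :
    ∃ C : Cert 49 56, C.c ≤ 227 / 50 ∧ C.check NE39SP.srcV NE39SP.tgtV NE39SP.wtLFQ (wOpen2 p.1 p.2) NE39SP.tLFQ 39 ∧
      ∃ θ : Fin 49 → ℝ, (∀ i, (paramsOpen2 p.1 p.2 D).pe θ i = (paramsOpen2 p.1 p.2 D).P0 i) ∧
        ∀ δ : ℝ → Fin 49 → ℝ, (paramsOpen2 p.1 p.2 D).IsSolution δ → δ 0 = NE39SP.δ₀ →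
          (∀ i ∈ NE39SP.genS, deriv (fun u => δ u i) 0 = 0) →
          ∀ t, 0 ≤ t → ∀ i ∈ NE39SP.genS,
            |deriv (fun u => δ u i) t| ≤ Real.sqrt (2 * (C.c : ℝ) / (NE39SP.MQ i : ℝ)) := by
  obtain ⟨C, -, hτ, hc, hchk, θ, -, -, heq, hcoh, hdyn⟩ := n2_switch_resync p hp D hD
  refine ⟨C, hc, hchk, θ, heq, fun δ hδ hδ0 hv0 t ht i hi => ?_⟩
  obtain ⟨hstay, -, -⟩ := hdyn δ hδ hδ0 hv0
  obtain ⟨hpol, hV⟩ := hstay t ht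
  have hbnn : ∀ i j, 0 ≤ (paramsOpen2 p.1 p.2 D).b i j := fun i j => by
    rw [paramsOpen2_b]
    exact symmetrize_nonneg (edgeWeight_nonneg fun e => by
      have := ((show C.check _ _ _ _ _ _ from hchk).2.1 e).2.1; exact_mod_cast this) i j
  have hτ1 : (C.τγ : ℝ) < 1 := by rw [hτ]; norm_num
  have h0 : ∀ i j, (paramsOpen2 p.1 p.2 D).b i j ≠ 0 → |θ i - θ j| ≤ π / 2 := by
    intro i j hij
    by_cases h : i = j
    · subst h
      rw [sub_self, abs_zero]
      positivity
    · exact ((hcoh i j h hij).trans (two_mul_arctan_lt_pi_div_two hτ1)).le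
  have := speed_le_of_energy_le (paramsOpen2_wellFormed p.1 p.2 hD) hbnn h0
    (fun i j hij => (hpol i j hij).le) hV i (by rw [paramsOpen2_gen]; exact hi)
  have hM : (paramsOpen2 p.1 p.2 D).M i = (NE39SP.MQ i : ℝ) := rfl
  rw [hM] at this
  exact this

end Summit.Ventures.GridStability.Bench.NE39SP

end
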